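import Literature.AlgebraicGeometry.Morphisms.ContainmentRepOfPushforwardTwist
import Literature.AlgebraicGeometry.Morphisms.ContainmentLocusFiniteFlat
import HarnessLib

/-!
# The containment locus «`X_T ⊆ Z_T`» is closed — the projective-flat road, assembled modulo the two sheaf inputs

[MumfordFogartyKirwan1994] Ch. 6 §3 Prop. 6.16 (p. 126) / [EGAIII2] 7.7: for `p : X ⟶ S` projective and flat and a closed subscheme
`Z = V(𝓘) ⊆ X`, the subfunctor `T ↦ {b : T ⟶ S | X_T ⊆ Z_T}` of `S` is represented by a CLOSED subscheme: twist by `𝒪_X(n)`,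
`n ≫ 0`, so that `𝓥 := p_*𝒪_X(n)` is a vector bundle whose formation commutes with base change and `𝓘(n)` is generated by
`𝓔 := p_*𝓘(n)`; then `X_T ⊆ Z_T` iff the base change of `u := p_*(ι(n)) : 𝓔 ⟶ 𝓥` vanishes, a closed condition.

THIS FILE is the END-TO-END ASSEMBLY of the cell's (h6) chain, modulo the two sheaf-theoretic inputs kept as NAMED HYPOTHESES at
an arbitrary invertible twist `L` (finite locally free of rank `1`):

* (hgen) `Epi ((pullbackPushforwardAdjunction p).counit.app (𝓘_Z ⊗ L))` — relative theorem A (chart form: ★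
  `Modules/PullbackPushforwardCounitEpi.epi_counit_of_span_restrict_eq_top`);
* (hbc) `∀ b, Mono (pushforwardBaseChangeHom pullback.condition (𝒪_X ⊗ L))` — `H⁰` base change for `p_*(𝒪_X ⊗ L)` (chart form: ★
  `Modules/PushforwardBaseChangeCharts.mono_pushforwardBaseChangeHom_of_charts`),

together with the vector-bundle data of ★ `Morphisms/ContainmentLocusClosed` (a frame system of `𝓥 = p_*(𝒪_X ⊗ L)`, `𝓔` and `𝓥^∨`
affine-localizing).  Heads: **`le_ker_fst_iff_pullback_map_twist_eq_zero`** — the socket `hrep` of ★ `ContainmentLocusClosed` for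
`u := p_*(ι ⊗ 𝟙_L)`, obtained as ★ `le_ker_iff_pullback_map_idealSheafOfι_eq_zero` (the ideal-sheaf bridge, ★ `ContainmentLocusFiniteFlat`
§5) followed by ★ `pullback_fst_map_eq_zero_iff_twist` (★ `ContainmentRepOfPushforwardTwist`); and the represented-containment heads
`vanishingIdeal_twist_le_ker_iff_containment`, **`exists_comp_subschemeι_eq_iff_containment_of_twist`**,
`existsUnique_comp_subschemeι_eq_iff_containment_of_twist` (★ `ContainmentLocusClosed` §2 at this `hrep`).

Theorems only; no `sorry`, no instance, no named fact.  Cell hodgecm-mathlib, F-DAG second wave (h6-d) FILE F.  HC_CM is proved only modulo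
the printed citations until rung 0 closes; this file discharges none of them.

## References
* [MumfordFogartyKirwan1994] D. Mumford, J. Fogarty, F. Kirwan, *Geometric Invariant Theory*, 3rd ed. (1994), Ch. 6 §3 Prop. 6.16 (p. 126).
* [Hartshorne1977] R. Hartshorne, *Algebraic Geometry* (1977), II Prop. 5.9 (PDF p. 146), III Theorem 12.11.
-/

noncomputable section

-- `TopCat.Presheaf`/`Scheme.Modules` are not reducible (as in Mathlib's `AlgebraicGeometry/Modules/Sheaf.lean`).
set_option backward.isDefEq.respectTransparency false

open CategoryTheory CategoryTheory.Limits AlgebraicGeometry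

universe u

namespace Literature.AlgebraicGeometry.Morphisms

open Literature.AlgebraicGeometry.Modules Literature.AlgebraicGeometry.Motives

section Twist

variable {X S : Scheme.{u}} (p : X ⟶ S) (I : X.IdealSheafData) {L : X.Modules}

/-- **The socket `hrep` for the twisted witness `u := p_*(ι ⊗ 𝟙_L) : p_*(𝓘_Z ⊗ L) ⟶ p_*(𝒪_X ⊗ L)`**: for every `b : T ⟶ S`,
`𝓘 ≤ (pullback.fst p b).ker ⟺ (Scheme.Modules.pullback b).map (p_*(ι ⊗ 𝟙_L)) = 0`, given (hgen) for `𝓘_Z ⊗ L` and (hbc) for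
`𝒪_X ⊗ L` — the ideal-sheaf bridge ★ `le_ker_iff_pullback_map_idealSheafOfι_eq_zero` followed by ★ `pullback_fst_map_eq_zero_iff_twist`.
[cite: MumfordFogartyKirwan1994, Ch. 6 §3 Prop. 6.16 (p. 126)] [cite: Hartshorne1977, III Theorem 12.11] -/
theorem le_ker_fst_iff_pullback_map_twist_eq_zero (hL : IsFiniteLocallyFree L) (h₁ : HasRank L 1)
    [Epi ((Scheme.Modules.pullbackPushforwardAdjunction p).counit.app (tensorObj (idealSheafOf I.subschemeι) L))]
    (hbc : ∀ ⦃T : Scheme.{u}⦄ (b : T ⟶ S),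
      Mono (pushforwardBaseChangeHom (pullback.condition (f := p) (g := b)) (tensorObj (unitModule X) L)))
    ⦃T : Scheme.{u}⦄ (b : T ⟶ S) :
    I ≤ (pullback.fst p b).ker ↔
      (Scheme.Modules.pullback b).map
        ((Scheme.Modules.pushforward p).map (tensorMap (idealSheafOfι I.subschemeι) (𝟙 L))) = 0 :=
  (le_ker_iff_pullback_map_idealSheafOfι_eq_zero I (pullback.fst p b)).trans
    (pullback_fst_map_eq_zero_iff_twist p (idealSheafOfι I.subschemeι) hL h₁ hbc b)

/-- **The containment locus is the closed subscheme `V(p_*(ι ⊗ 𝟙_L)) ⊆ S`** (ideal form; [MumfordFogartyKirwan1994] Prop. 6.16):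
for every `b : T ⟶ S`, `vanishingIdeal (p_*(ι ⊗ 𝟙_L)) ≤ b.ker ↔ X_T ⊆ Z_T` — ★ `ContainmentLocusClosed.vanishingIdeal_le_ker_iff_containment`
at the `hrep` of this file; data: a frame system of the vector bundle `p_*(𝒪_X ⊗ L)`, `p_*(𝓘_Z ⊗ L)` and `p_*(𝒪_X ⊗ L)^∨`
affine-localizing, (hgen), (hbc). [cite: MumfordFogartyKirwan1994, Ch. 6 §3 Prop. 6.16 (p. 126)] [cite: Hartshorne1977, II Prop. 5.9 (PDF p. 146)] -/
theorem vanishingIdeal_twist_le_ker_iff_containment (hL : IsFiniteLocallyFree L) (h₁ : HasRank L 1)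
    (F : FrameSystem ((Scheme.Modules.pushforward p).obj (tensorObj (unitModule X) L)))
    (hE : IsAffineLocalizing ((Scheme.Modules.pushforward p).obj (tensorObj (idealSheafOf I.subschemeι) L)))
    (hV : IsAffineLocalizing (dual ((Scheme.Modules.pushforward p).obj (tensorObj (unitModule X) L))))
    [Epi ((Scheme.Modules.pullbackPushforwardAdjunction p).counit.app (tensorObj (idealSheafOf I.subschemeι) L))]
    (hbc : ∀ ⦃T : Scheme.{u}⦄ (b : T ⟶ S),
      Mono (pushforwardBaseChangeHom (pullback.condition (f := p) (g := b)) (tensorObj (unitModule X) L)))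
    {T : Scheme.{u}} (b : T ⟶ S) :
    vanishingIdeal ((Scheme.Modules.pushforward p).map (tensorMap (idealSheafOfι I.subschemeι) (𝟙 L))) ≤ b.ker ↔
      I ≤ (pullback.fst p b).ker :=
  vanishingIdeal_le_ker_iff_containment p I _ F hE hV (le_ker_fst_iff_pullback_map_twist_eq_zero p I hL h₁ hbc) b

/-- **The containment locus REPRESENTS containment** (factorisation form): `b : T ⟶ S` factors through the closed subscheme
`V(p_*(ι ⊗ 𝟙_L)) ⟶ S` iff `X_T ⊆ Z_T` — the projective-flat road of the cell's (h6) leaf, end to end modulo (hgen)/(hbc).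
[cite: MumfordFogartyKirwan1994, Ch. 6 §3 Prop. 6.16 (p. 126)] [cite: Hartshorne1977, II Prop. 5.9 (PDF p. 146)] -/
theorem exists_comp_subschemeι_eq_iff_containment_of_twist (hL : IsFiniteLocallyFree L) (h₁ : HasRank L 1)
    (F : FrameSystem ((Scheme.Modules.pushforward p).obj (tensorObj (unitModule X) L)))
    (hE : IsAffineLocalizing ((Scheme.Modules.pushforward p).obj (tensorObj (idealSheafOf I.subschemeι) L)))
    (hV : IsAffineLocalizing (dual ((Scheme.Modules.pushforward p).obj (tensorObj (unitModule X) L))))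
    [Epi ((Scheme.Modules.pullbackPushforwardAdjunction p).counit.app (tensorObj (idealSheafOf I.subschemeι) L))]
    (hbc : ∀ ⦃T : Scheme.{u}⦄ (b : T ⟶ S),
      Mono (pushforwardBaseChangeHom (pullback.condition (f := p) (g := b)) (tensorObj (unitModule X) L)))
    {T : Scheme.{u}} (b : T ⟶ S) :
    (∃ b' : T ⟶ (vanishingIdeal ((Scheme.Modules.pushforward p).map
        (tensorMap (idealSheafOfι I.subschemeι) (𝟙 L)))).subscheme,
      b' ≫ (vanishingIdeal ((Scheme.Modules.pushforward p).map
        (tensorMap (idealSheafOfι I.subschemeι) (𝟙 L)))).subschemeι = b) ↔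
      I ≤ (pullback.fst p b).ker :=
  exists_comp_subschemeι_eq_iff_containment p I _ F hE hV (le_ker_fst_iff_pullback_map_twist_eq_zero p I hL h₁ hbc) b

/-- Unique factorisation (the closed subscheme `V(p_*(ι ⊗ 𝟙_L))` is a subfunctor of `S` representing containment).
[cite: MumfordFogartyKirwan1994, Ch. 6 §3 Prop. 6.16 (p. 126)] [cite: Hartshorne1977, II Prop. 5.9 (PDF p. 146)] -/
theorem existsUnique_comp_subschemeι_eq_iff_containment_of_twist (hL : IsFiniteLocallyFree L) (h₁ : HasRank L 1)
    (F : FrameSystem ((Scheme.Modules.pushforward p).obj (tensorObj (unitModule X) L)))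
    (hE : IsAffineLocalizing ((Scheme.Modules.pushforward p).obj (tensorObj (idealSheafOf I.subschemeι) L)))
    (hV : IsAffineLocalizing (dual ((Scheme.Modules.pushforward p).obj (tensorObj (unitModule X) L))))
    [Epi ((Scheme.Modules.pullbackPushforwardAdjunction p).counit.app (tensorObj (idealSheafOf I.subschemeι) L))]
    (hbc : ∀ ⦃T : Scheme.{u}⦄ (b : T ⟶ S),
      Mono (pushforwardBaseChangeHom (pullback.condition (f := p) (g := b)) (tensorObj (unitModule X) L)))
    {T : Scheme.{u}} (b : T ⟶ S) :
    (∃! b' : T ⟶ (vanishingIdeal ((Scheme.Modules.pushforward p).map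
        (tensorMap (idealSheafOfι I.subschemeι) (𝟙 L)))).subscheme,
      b' ≫ (vanishingIdeal ((Scheme.Modules.pushforward p).map
        (tensorMap (idealSheafOfι I.subschemeι) (𝟙 L)))).subschemeι = b) ↔
      I ≤ (pullback.fst p b).ker :=
  existsUnique_comp_subschemeι_eq_iff_containment p I _ F hE hV
    (le_ker_fst_iff_pullback_map_twist_eq_zero p I hL h₁ hbc) b

end Twist

end Literature.AlgebraicGeometry.Morphisms

end
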